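import Mathlib
import HarnessLib
import Literature.Computability.AlgebraicComplexity.KabanetsImpagliazzoHardness
import Literature.Computability.AlgebraicComplexity.CircuitDepthProductDepthOne
import Literature.Computability.MetaComplexity.NWGenerator
import Summits.ValiantsHypothesis.ValiantsHypothesis.Theorems.DefinabilityGapAffineRung
import Summits.ValiantsHypothesis.ValiantsHypothesis.Theorems.DefinabilityGapKIHybridCD
import Summits.ValiantsHypothesis.ValiantsHypothesis.Theorems.DepthWindowConstDepth

/-!
# DefinabilityGap — the constant-depth rung of `K1 = KIPlantedHitting`, ALL size exponents
# (support for item `stmt-ValiantsHypothesis-23547`; decomp-valiant lens 5, generation 12)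

`K1 = KIPlantedHitting` (route `route-ValiantsHypothesis-DefinabilityGap`, the record's residual): for every `b`,
infinitely often the KI-planted permanent map `G_m = kiPer m` (Kabanets–Impagliazzo generator with the quadratic-curve
design over `𝔽_q`, `q = qOf m`, planted with the padded permanent `per_m`) hits every nonzero `D` of circuit complexity
and degree `≤ q^b`.  The lineage's proved rungs so far are indexed by the SIZE exponent (`b = 1`,
`DefinabilityGapGirth.kiPlantedHitting_one`).  This file opens the DEPTH axis and climbs it to every constant:

* `K1cd` (spelled out in `kiPlantedHittingCD_of_cdFactorClosure`) — `K1` restricted to annihilators computed by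
  unbounded-fan-in circuits of constant PRODUCT-DEPTH `Δ` with `≤ q^b` WIRES (the Limaye–Srinivasan–Tavenas size measure
  `ArithCircuit.edgeSize`), for ALL `Δ` and ALL `b`;
* `kiPlantedHittingCD_of_cdFactorClosure : CDFactorClosure → K1cd` — PROVED (kernel), where the hypothesis
  `CDFactorClosure` is the 2025 closure theorem of Bhattacharjee–Kumar–Rai–Ramanathan–Saptharishi–Saraf
  ("constant-depth circuits are closed under taking factors", [BhattacharjeeEtAl2025, Thm. 1]) typed in the tree's
  (product-depth, wires) currency as an explicit hypothesis — exactly as the lineage typed Sinhababu–Thierauf's `VBP`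
  factor closure for the `VP_ws` notch (`DefinabilityGapKIReconstructionWs`).

Chain (all kernel except the named closure input):
1. `DefinabilityGapKIHybridCD.exists_cd_root_of_kiGenerator_annihilated` (companion file) — KI Lemma 30 part I (the
   hybrid argument) in (product-depth, wires) currency for every NW design: a nonzero annihilator `D` computed by `Γ`
   yields a nonzero `H(x, c)` with `H(x, f(x)) = 0` computed in product-depth `≤ pdepth Γ + 1` with
   `≤ wires Γ + #ι · (deg f + 1)^{r+1}` wires (composition calculus `ArithCircuit.compose`; the substituted inputs are
   restricted copies of `f` on `≤ r` live variables, realised as `ΣΠ` circuits transported along a projection).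
2. Gauss (`X_sub_rename_dvd_of_root`): `(perPad - c) ∣ H`; the closure input gives a constant-depth circuit for it;
   `per_m` is a projection of `perPad - c` (`exists_circuit_of_isProjection`, lens 4's transport lemma).
3. `DepthWindow.perHardConstDepth` (lens 4, PROVED from the in-tree Limaye–Srinivasan–Tavenas theorem via the `IMM`
   projection): `per` has no polynomial-wire circuits of any constant product-depth — contradiction.

So on the constant-depth slice the hardness–randomness descent `K1 ⟸ (per hard)` CLOSES UNCONDITIONALLY up to the
named 2025 fact: [BhattacharjeeEtAl2025, Thm. 37] is this statement in print for an abstract hard family; here it is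
the lineage's concrete `G_m`.  Honest framing: a rung (S-implied slice of `K1`), not a descent; `VP ≠ VNP` untouched;
for GROWING depth `Δ(m)` the same chain runs into lens 4's depth window (per-hardness known only up to
`o(log log)`-type depths), i.e. the depth axis of `K1` and the `DepthWindow` residual share one wall.

References: [KabanetsImpagliazzo2003] Lemma 28, Lemma 30, Thm. 7.7; [BhattacharjeeEtAl2025] Thm. 1, Thm. 37 (p. 17);
[LimayeSrinivasanTavenas2025] Cor. 4; [Burgisser2000] §2 (projections, composition).
-/

set_option linter.dupNamespace false

noncomputable section

open MvPolynomial
open Literature.Computability.AlgebraicComplexity Literature.Computability.MetaComplexity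
open Summit.ValiantsHypothesis.ValiantsHypothesis.Theorems.DefinabilityGapAffineRung
  (qOf qOf_spec sq_le_qOf quadDesign kiPer quadDesign_isNWDesign)
open Summit.ValiantsHypothesis.ValiantsHypothesis.Theorems.DepthWindow
  (perHardConstDepth exists_circuit_of_isProjection)
open Summit.ValiantsHypothesis.ValiantsHypothesis.Theorems.DefinabilityGapKIHybridCD
  (exists_cd_root_of_kiGenerator_annihilated)

namespace Summit.ValiantsHypothesis.ValiantsHypothesis.Theorems.DefinabilityGapK1ConstDepthRung

/-! ## The statements: the constant-depth rung of `K1`, and the closure input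

Both are spelled out inside `kiPlantedHittingCD_of_cdFactorClosure` (no `Prop` definitions are vendored here):

* **`K1cd`** — the constant-product-depth slice of `K1 = KIPlantedHitting`, all size exponents: for every
  product-depth `Δ`, every exponent `b` and every `m₀` there is `m ≥ m₀` such that every nonzero `D` of degree `≤ q^b`
  computed by an unbounded-fan-in circuit of product-depth `≤ Δ` with `≤ q^b` wires is hit by the KI-planted permanent
  map: `D ∘ G_m ≠ 0` (`q = qOf m`, `G_m = kiPer m`).  Implied by `KIPlantedHitting` (a wire-size-`s` circuit has
  complexity `O(s)`). [cite: KabanetsImpagliazzo2003, Thm. 7.7] [cite: BhattacharjeeEtAl2025, Thm. 37]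
* **`CDFactorClosure`** (the hypothesis `hfac`) — constant-depth circuits are closed under taking factors
  (Bhattacharjee–Kumar–Rai–Ramanathan–Saptharishi–Saraf 2025, Thm. 1: over a field of characteristic zero, a factor of
  an `n`-variate degree-`d` polynomial with a size-`s` depth-`Δ` circuit has a circuit of size `poly(s, d, n)` and depth
  `Δ + O(1)`), typed in the tree's Limaye–Srinivasan–Tavenas currency (product-depth `ArithCircuit.productDepth`, wires
  `ArithCircuit.edgeSize`; a circuit of product-depth `Δ` with `e` wires is a depth-`2Δ + O(1)` circuit with `poly(e)`
  wires after merging sum chains, and depth bounds product-depth), with the polynomial and the depth increment allowed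
  to depend on `Δ`:  `∀ Δ, ∃ Δ' a, ∀ σ P Q Γ, Γ computes P → pdepth Γ ≤ Δ → P ≠ 0 → Q ∣ P → ∃ Γ', Γ' computes Q ∧
  pdepth Γ' ≤ Δ' ∧ wires Γ' ≤ (wires Γ + deg P + #σ + 2)^a`.  A NAMED PRINT FACT used as a hypothesis, not proved
  here. [cite: BhattacharjeeEtAl2025, Thm. 1]
-/

/-! ## KI reconstruction in (product-depth, wires) currency for the KI-planted permanent map -/

/-- **Steps 1–3 for `G_m = kiPer m`**: from a nonzero annihilator `D` of `G_m` computed in product-depth `≤ Δ` and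
factor closure at product-depth `Δ + 1`, a constant-depth circuit for `per_m` with polynomially many wires:
hybrid (`exists_cd_root_of_kiGenerator_annihilated` with the quadratic-curve design, `r = 2`), Gauss
(`X_sub_rename_dvd_of_root`: `(perPad - c) ∣ H`), closure, and the projection `perPad - c ↦ per_m` (`c ↦ 0`,
un-padding). [cite: KabanetsImpagliazzo2003, Lemma 28, Lemma 30] [cite: BhattacharjeeEtAl2025, Thm. 37] -/
theorem exists_cd_circuit_perPoly {Δ Δ' a : ℕ}
    (hfac : ∀ (σ : Type) [Fintype σ] [DecidableEq σ] (P Q : MvPolynomial σ ℂ) (Γ : ArithCircuit ℂ σ),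
      Γ.Computes P → Γ.productDepth ≤ Δ + 1 → P ≠ 0 → Q ∣ P →
      ∃ Γ' : ArithCircuit ℂ σ, Γ'.Computes Q ∧ Γ'.productDepth ≤ Δ' ∧
        Γ'.edgeSize ≤ (Γ.edgeSize + P.totalDegree + Fintype.card σ + 2) ^ a)
    (m : ℕ) {Γ : ArithCircuit ℂ (Fin 3 → Fin (qOf m))} {D : MvPolynomial (Fin 3 → Fin (qOf m)) ℂ}
    (hC : Γ.Computes D) (hΔ : Γ.productDepth ≤ Δ) (hD : D ≠ 0) (hann : bind₁ (kiPer m) D = 0) :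
    ∃ Γ' : ArithCircuit ℂ (Fin m × Fin m), Γ'.Computes (perPoly (Fin m) ℂ) ∧ Γ'.productDepth ≤ Δ' ∧
      Γ'.edgeSize ≤ (Γ.edgeSize + qOf m ^ 3 * ((m + 1) ^ 2 * (m + 1)) + D.totalDegree * max 1 m +
        (qOf m + 1) + 2) ^ a := by
  classical
  set f : MvPolynomial (Fin (qOf m)) ℂ := perPad ℂ (sq_le_qOf m) with hf
  obtain ⟨H, hH, hroot, hdegH, P, hPc, hPd, hPe⟩ :=
    exists_cd_root_of_kiGenerator_annihilated (quadDesign_isNWDesign m) f hD hann Γ hC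
  have hdegf : f.totalDegree ≤ m := totalDegree_perPad_le (F := ℂ) (sq_le_qOf m)
  -- Gauss: `(perPad - c) ∣ H`
  set Q : MvPolynomial (Option (Fin (qOf m))) ℂ := rename some f - X none with hQ
  have hdvd : Q ∣ H := by
    have h := X_sub_rename_dvd_of_root f hroot
    rw [hQ, ← neg_sub]
    exact (neg_dvd).2 h
  -- closure at product-depth `Δ + 1`
  obtain ⟨CQ, hCQc, hCQd, hCQe⟩ := hfac (Option (Fin (qOf m))) H Q P hPc (hPd.trans (by omega)) hH hdvd
  -- `per_m` is a projection of `perPad - c`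
  have hproj : IsProjection (perPoly (Fin m) ℂ) Q := by
    refine ⟨fun o => o.elim (C 0) fun j =>
      if h : ∃ ij, permPad (sq_le_qOf m) ij = j then X h.choose else C 0, ?_, ?_⟩
    · rintro (_ | j)
      · exact Or.inr ⟨0, rfl⟩
      · by_cases h : ∃ ij, permPad (sq_le_qOf m) ij = j
        · exact Or.inl ⟨h.choose, by simp only [Option.elim_some, dif_pos h]⟩
        · exact Or.inr ⟨0, by simp only [Option.elim_some, dif_neg h]⟩
    · rw [hQ, map_sub, aeval_X, hf, perPad, aeval_rename, aeval_rename]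
      have hcomp : ((fun o : Option (Fin (qOf m)) => o.elim (C (0 : ℂ) : MvPolynomial (Fin m × Fin m) ℂ) fun j =>
          if h : ∃ ij, permPad (sq_le_qOf m) ij = j then X h.choose else C 0) ∘ some) ∘
            permPad (sq_le_qOf m) = X := by
        funext ij
        have h : ∃ ij', permPad (sq_le_qOf m) ij' = permPad (sq_le_qOf m) ij := ⟨ij, rfl⟩
        have hc : h.choose = ij := (permPad (sq_le_qOf m)).injective h.choose_spec
        simp only [Function.comp_apply, Option.elim_some, dif_pos h, hc]
      rw [hcomp, aeval_X_left]
      simp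
  obtain ⟨Γ', hC'c, hC'd, hC'e, -⟩ := exists_circuit_of_isProjection hproj CQ hCQc
  refine ⟨Γ', hC'c, hC'd.trans hCQd, hC'e.trans (hCQe.trans (Nat.pow_le_pow_left ?_ a))⟩
  -- the base of the polynomial bound
  have hcard : Fintype.card (Fin 3 → Fin (qOf m)) = qOf m ^ 3 := by simp [Fintype.card_fin]
  have hP' : P.edgeSize ≤ Γ.edgeSize + qOf m ^ 3 * ((m + 1) ^ 2 * (m + 1)) := by
    refine hPe.trans ?_
    rw [hcard]
    gcongr
  have hH' : H.totalDegree ≤ D.totalDegree * max 1 m := hdegH.trans (by gcongr)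
  have hopt : Fintype.card (Option (Fin (qOf m))) = qOf m + 1 := by simp
  rw [hopt]
  omega

/-! ## Arithmetic and the contradiction with `perHardConstDepth` -/

/-- `A (m+1)^K ≤ m^c + c` for `c = K + A·2^K`. [folklore] -/
theorem exists_poly_le_pow_add (A K : ℕ) : ∃ c : ℕ, ∀ m : ℕ, A * (m + 1) ^ K ≤ m ^ c + c := by
  refine ⟨K + A * 2 ^ K, fun m => ?_⟩
  have hA : A ≤ A * 2 ^ K := Nat.le_mul_of_pos_right A (Nat.two_pow_pos K)
  rcases Nat.lt_or_ge m 2 with hm | hm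
  · interval_cases m
    · calc A * (0 + 1) ^ K = A := by simp
        _ ≤ K + A * 2 ^ K := hA.trans (Nat.le_add_left _ _)
        _ ≤ 0 ^ (K + A * 2 ^ K) + (K + A * 2 ^ K) := Nat.le_add_left _ _
    · calc A * (1 + 1) ^ K = A * 2 ^ K := by norm_num
        _ ≤ K + A * 2 ^ K := Nat.le_add_left _ _
        _ ≤ 1 ^ (K + A * 2 ^ K) + (K + A * 2 ^ K) := Nat.le_add_left _ _
  · calc A * (m + 1) ^ K ≤ A * (2 * m) ^ K := Nat.mul_le_mul_left _ (Nat.pow_le_pow_left (by omega) K)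
      _ = A * 2 ^ K * m ^ K := by rw [mul_pow, mul_assoc]
      _ ≤ m ^ (A * 2 ^ K) * m ^ K := by
          refine Nat.mul_le_mul_right _ ?_
          exact (Nat.lt_two_pow_self).le.trans (Nat.pow_le_pow_left hm _)
      _ = m ^ (K + A * 2 ^ K) := by rw [← pow_add, add_comm]
      _ ≤ m ^ (K + A * 2 ^ K) + (K + A * 2 ^ K) := Nat.le_add_right _ _

/-- **`per` is hard at every constant product-depth, infinitely often** (from lens 4's `perHardConstDepth`): for
`Δ₁ ≥ 1`, every `c` and every `m₀` there is `n ≥ m₀` such that every product-depth-`≤ Δ₁` circuit for `per_n` has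
`> n^c + c` wires (the finitely many `n < m₀` are absorbed into the constant via their `ΣΠ` circuits).
[cite: LimayeSrinivasanTavenas2025, Cor. 4] -/
theorem perHard_io {Δ₁ : ℕ} (hΔ₁ : 1 ≤ Δ₁) (c m₀ : ℕ) :
    ∃ n, m₀ ≤ n ∧ ∀ Γ : ArithCircuit ℂ (Fin n × Fin n), Γ.Computes (perPoly (Fin n) ℂ) →
      Γ.productDepth ≤ Δ₁ → n ^ c + c < Γ.edgeSize := by
  classical
  by_contra hcon
  push Not at hcon
  have hsmall : ∀ n : ℕ, ∃ Γ : ArithCircuit ℂ (Fin n × Fin n), Γ.Computes (perPoly (Fin n) ℂ) ∧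
      Γ.productDepth ≤ Δ₁ := fun n => by
    obtain ⟨P, -, hP, hd⟩ :=
      ArithCircuit.exists_computes_productDepth_one_holds (k := ℂ) (σ := Fin n × Fin n) (perPoly (Fin n) ℂ)
    exact ⟨P, hP, hd.trans hΔ₁⟩
  choose C₀ hC₀c hC₀d using hsmall
  set B : ℕ := (Finset.range m₀).sup fun n => (C₀ n).edgeSize with hB
  refine perHardConstDepth Δ₁ ⟨c + B + 1, fun n => ?_⟩
  by_cases hn : m₀ ≤ n
  · obtain ⟨Γ, hCc, hCd, hCe⟩ := hcon n hn
    refine ⟨Γ, hCc, hCd, hCe.trans ?_⟩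
    rcases Nat.eq_zero_or_pos n with rfl | hpos
    · have h0 : (0 : ℕ) ^ c ≤ 1 := by
        rcases Nat.eq_zero_or_pos c with rfl | hc
        · simp
        · rw [zero_pow (by omega)]; exact Nat.zero_le _
      omega
    · have h1 : n ^ c ≤ n ^ (c + B + 1) := Nat.pow_le_pow_right hpos (by omega)
      omega
  · push Not at hn
    refine ⟨C₀ n, hC₀c n, hC₀d n, ?_⟩
    have hle : (C₀ n).edgeSize ≤ B :=
      Finset.le_sup (f := fun n => (C₀ n).edgeSize) (Finset.mem_range.2 hn)
    omega

/-- `q(m) = leastPrimeGe (m² + 1) ≤ 4 (m+1)²` (Bertrand). [folklore] -/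
theorem qOf_le_four_mul_sq (m : ℕ) : qOf m ≤ 4 * (m + 1) ^ 2 := by
  have h := leastPrimeGe_le (m * m + 1) (by omega)
  have hsq : (m + 1) ^ 2 = m * m + 2 * m + 1 := by ring
  change leastPrimeGe (m * m + 1) ≤ _
  omega

/-- **THE CONSTANT-DEPTH RUNG OF `K1`, PROVED from the 2025 closure theorem**: `CDFactorClosure → KIPlantedHittingCD`.
For fixed `Δ, b`: a nonzero depth-`Δ` annihilator of `G_m` with `≤ q^b` wires and degree `≤ q^b` would give
(`exists_cd_circuit_perPoly`) circuits for `per_m` of product-depth `Δ'` and `≤ (2·4^b + 71)^a (m+1)^{a(2b+9)}` wires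
for all large `m`, contradicting `perHard_io` (Limaye–Srinivasan–Tavenas via lens 4's `perHardConstDepth`).
[cite: BhattacharjeeEtAl2025, Thm. 1, Thm. 37] [cite: KabanetsImpagliazzo2003, Thm. 7.7]
[cite: LimayeSrinivasanTavenas2025, Cor. 4] -/
theorem kiPlantedHittingCD_of_cdFactorClosure
    (hfac : ∀ Δ : ℕ, ∃ Δ' a : ℕ, ∀ (σ : Type) [Fintype σ] [DecidableEq σ] (P Q : MvPolynomial σ ℂ)
      (Γ : ArithCircuit ℂ σ), Γ.Computes P → Γ.productDepth ≤ Δ → P ≠ 0 → Q ∣ P →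
      ∃ Γ' : ArithCircuit ℂ σ, Γ'.Computes Q ∧ Γ'.productDepth ≤ Δ' ∧
        Γ'.edgeSize ≤ (Γ.edgeSize + P.totalDegree + Fintype.card σ + 2) ^ a) :
    ∀ Δ b m₀ : ℕ, ∃ m, m₀ ≤ m ∧
      ∀ (Γ : ArithCircuit ℂ (Fin 3 → Fin (qOf m))) (D : MvPolynomial (Fin 3 → Fin (qOf m)) ℂ),
        Γ.Computes D → Γ.productDepth ≤ Δ → Γ.edgeSize ≤ qOf m ^ b → D ≠ 0 → D.totalDegree ≤ qOf m ^ b →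
        bind₁ (kiPer m) D ≠ 0 := by
  classical
  intro Δ b m₀
  obtain ⟨Δ', a, hfac'⟩ := hfac (Δ + 1)
  obtain ⟨c, hc⟩ := exists_poly_le_pow_add ((2 * 4 ^ b + 71) ^ a) (a * (2 * b + 9))
  obtain ⟨n, hn, hhard⟩ := perHard_io (Δ₁ := max Δ' 1) (le_max_right _ _) c m₀
  refine ⟨n, hn, fun Γ D hC hΔ hCe hD hdeg hann => ?_⟩
  obtain ⟨Γ', hC'c, hC'd, hC'e⟩ := exists_cd_circuit_perPoly hfac' n hC hΔ hD hann
  have hlt := hhard Γ' hC'c (hC'd.trans (le_max_left _ _))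
  -- the polynomial bound on the wires of `Γ'`
  have hX : 0 < n + 1 := Nat.succ_pos n
  have hq : qOf n ≤ 4 * (n + 1) ^ 2 := qOf_le_four_mul_sq n
  have hmono : ∀ i j : ℕ, i ≤ j → (n + 1) ^ i ≤ (n + 1) ^ j := fun i j h => Nat.pow_le_pow_right hX h
  have hqb : qOf n ^ b ≤ 4 ^ b * (n + 1) ^ (2 * b) := by
    calc qOf n ^ b ≤ (4 * (n + 1) ^ 2) ^ b := Nat.pow_le_pow_left hq b
      _ = 4 ^ b * (n + 1) ^ (2 * b) := by rw [mul_pow, ← pow_mul]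
  have t1 : Γ.edgeSize ≤ 4 ^ b * (n + 1) ^ (2 * b + 9) :=
    hCe.trans (hqb.trans (Nat.mul_le_mul_left _ (hmono _ _ (by omega))))
  have t2 : qOf n ^ 3 * ((n + 1) ^ 2 * (n + 1)) ≤ 64 * (n + 1) ^ (2 * b + 9) := by
    calc qOf n ^ 3 * ((n + 1) ^ 2 * (n + 1)) ≤ (4 * (n + 1) ^ 2) ^ 3 * ((n + 1) ^ 2 * (n + 1)) :=
          Nat.mul_le_mul_right _ (Nat.pow_le_pow_left hq 3)
      _ = 64 * (n + 1) ^ 9 := by ring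
      _ ≤ 64 * (n + 1) ^ (2 * b + 9) := Nat.mul_le_mul_left _ (hmono _ _ (by omega))
  have t3 : D.totalDegree * max 1 n ≤ 4 ^ b * (n + 1) ^ (2 * b + 9) := by
    calc D.totalDegree * max 1 n ≤ (4 ^ b * (n + 1) ^ (2 * b)) * (n + 1) :=
          Nat.mul_le_mul (hdeg.trans hqb) (max_le (by omega) (by omega))
      _ = 4 ^ b * (n + 1) ^ (2 * b + 1) := by rw [mul_assoc, ← pow_succ]
      _ ≤ 4 ^ b * (n + 1) ^ (2 * b + 9) := Nat.mul_le_mul_left _ (hmono _ _ (by omega))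
  have t4 : qOf n + 1 + 2 ≤ 7 * (n + 1) ^ (2 * b + 9) := by
    have h1 : 1 ≤ (n + 1) ^ 2 := Nat.one_le_pow _ _ hX
    calc qOf n + 1 + 2 ≤ 7 * (n + 1) ^ 2 := by omega
      _ ≤ 7 * (n + 1) ^ (2 * b + 9) := Nat.mul_le_mul_left _ (hmono _ _ (by omega))
  have hbase : Γ.edgeSize + qOf n ^ 3 * ((n + 1) ^ 2 * (n + 1)) + D.totalDegree * max 1 n + (qOf n + 1) + 2 ≤
      (2 * 4 ^ b + 71) * (n + 1) ^ (2 * b + 9) := by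
    have heq : 4 ^ b * (n + 1) ^ (2 * b + 9) + 64 * (n + 1) ^ (2 * b + 9) + 4 ^ b * (n + 1) ^ (2 * b + 9) +
        7 * (n + 1) ^ (2 * b + 9) = (2 * 4 ^ b + 71) * (n + 1) ^ (2 * b + 9) := by ring
    omega
  have hfin : Γ'.edgeSize ≤ n ^ c + c := by
    calc Γ'.edgeSize ≤ _ := hC'e
      _ ≤ ((2 * 4 ^ b + 71) * (n + 1) ^ (2 * b + 9)) ^ a := Nat.pow_le_pow_left hbase a
      _ = (2 * 4 ^ b + 71) ^ a * (n + 1) ^ (a * (2 * b + 9)) := by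
          rw [mul_pow, ← pow_mul, mul_comm (2 * b + 9) a]
      _ ≤ n ^ c + c := hc n
  omega

end Summit.ValiantsHypothesis.ValiantsHypothesis.Theorems.DefinabilityGapK1ConstDepthRung

end
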